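import Literature.NumberTheory.EllipticCurves.RingClassFieldInertia
import Literature.NumberTheory.EllipticCurves.HeegnerPointsKolyvaginConjugation
import Summits.BirchSwinnertonDyer.Rank1Residual.X11b.RingClassFieldConj
import Summits.BirchSwinnertonDyer.Rank1Residual.X11b.RingClassGalArtin
import HarnessLib

/-!
# Route `CMKolyvaginAtInertTwo`, crux `CMKolyvaginExactAtInertTwo` (stmt-BirchSwinnertonDyer-24277) —
# GENUS TRIVIALITY, FILE 2: INERTIA ABOVE A PRIME OF `d_K` ACTS ON A RING CLASS FIELD THROUGH AN
# INVOLUTION (the `g • g • a = a` input of `KolyvaginGenusTwo.kolyvaginClass_mem_selmerLocalKer_of_sq_of_deep`)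

Seat `bsd-line-cmk2-p1` g20 (cell `bsd-print-cf2`), `--supports stmt-BirchSwinnertonDyer-24277` (helper;
closes nothing).  THEOREMS ONLY (no definition, no named fact, no `sorry`).  BSD is NOT proved by any
of this; the crux is not closed here.

WHAT.  `K` imaginary quadratic, `ι : K → ℂ`, `m ≠ 0`, `K[m] = ringClassField K ι m ⊂ ℂ` (Galois
over `ℚ`, Cox Lemma 9.3 = x11b3's `isGalois_rat_ringClassField`), `emb : K[m] → ℚ̄` any ring map,
`q` a prime NOT dividing `m` (no hypothesis `q ∣ d_K` is needed: at `q ∤ d_K` the statement is the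
weaker half of "inertia acts trivially"), `𝔓` a prime of `\bar ℤ` above `q`, `g ∈ I_𝔓 ≤ Γ_ℚ`.  Then

* `apply_apply_emb_eq_of_mem_inertia` — **`g (g (emb x)) = emb x` for every `x ∈ K[m]`**: `g`
  restricts to `σ ∈ Aut_ℚ(K[m])` (`exists_algEquiv_comp_eq`); `σ² ∈ 𝒢_m = Gal(K[m]/K)` because
  `[Aut_ℚ(K[m]) : 𝒢_m] = 2` (x11b3 `index_ringClassGal_eq_two`, Mathlib
  `Subgroup.mul_self_mem_of_index_two`); as a `K`-automorphism (`RingClassTower.exists_hom_ringClassGal_algEquiv`)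
  `σ²` lies in the inertia group of the prime `P = emb⁻¹(𝔓) ∩ 𝓞_{K[m]}` over the prime `𝔭 = P ∩ 𝓞_K`,
  which has order `e(P ∣ 𝔭) = 1` since `K[m]/K` is unramified at `𝔭 ∌ m` (Cox §9.A, tree
  `isUnramifiedIn_ringClassField`; Mathlib `Ideal.card_inertia_eq_ramificationIdxIn`) — so `σ² = 1`.
* `smul_smul_map_eq_of_mem_inertia` — the same on points: for `W/ℚ` and `P ∈ E(K[m])`,
  `g • g • (emb_* P) = emb_* P` in `E(ℚ̄)`.

References: [Cox2013] §9.A (p. 181) and Lemma 9.3; [NeukirchANT1999] Ch. I §9 Prop. (9.6);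
[GrossLMS1991] §3 (`K_n/ℚ` generalized dihedral), §4 proof of Lemma 4.3.
-/

set_option autoImplicit false
-- the Theorems namespace of this sub repeats the summit name by design (D-0017 nested layout)
set_option linter.dupNamespace false

noncomputable section

open scoped Classical NumberField Pointwise

namespace Summit.BirchSwinnertonDyer.BirchSwinnertonDyer.Theorems.KolyvaginGenusTwo

open NumberField IsDedekindDomain Field WeierstrassCurve Rat.HeightOneSpectrum
open Literature.NumberTheory.EllipticCurves Literature.NumberTheory.EllipticCurves.RingClassField
open Literature.NumberTheory.GaloisRepresentations
open Summit.BirchSwinnertonDyer.Rank1Residual.X11b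

variable {K : Type} [Field K] [NumberField K]

/-- **Inertia above `q ∤ m` acts on `K[m]` through an involution.**  See the module docstring.
[cite: Cox2013, §9.A Lemma 9.3 and p. 181] [cite: NeukirchANT1999, Ch. I §9 Prop. (9.6)] -/
theorem apply_apply_emb_eq_of_mem_inertia (hK : IsImaginaryQuadratic K) (ιK : K →+* ℂ) {m : ℕ}
    (hm : m ≠ 0) (emb : ringClassField K ιK m →+* AlgebraicClosure ℚ)
    {q : ℕ} (hq : q.Prime) (hqm : ¬ q ∣ m)
    {u : HeightOneSpectrum (𝓞 ℚ)} (hu : (primesEquiv u : ℕ) = q)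
    {𝔓 : Ideal (absIntegers (𝓞 ℚ) ℚ)} (h𝔓 : 𝔓 ∈ u.primesAbove)
    {g : absoluteGaloisGroup ℚ} (hg : g ∈ 𝔓.inertia (absoluteGaloisGroup ℚ))
    (x : ringClassField K ιK m) : g • g • emb x = emb x := by
  haveI hfdK := (finiteDimensional_and_isGalois_ringClassField hK ιK hm).1
  haveI hgalK := (finiteDimensional_and_isGalois_ringClassField hK ιK hm).2
  haveI : IsGalois ℚ (ringClassField K ιK m) := RingClassConj.isGalois_rat_ringClassField hK ιK hm
  haveI : FiniteDimensional ℚ (ringClassField K ιK m) := Module.Finite.trans K _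
  haveI : NumberField (ringClassField K ιK m) := NumberField.of_module_finite K _
  -- `emb` is a `ℚ`-algebra map
  have hemb : ∀ k : ℚ, emb (algebraMap ℚ (ringClassField K ιK m) k) =
      algebraMap ℚ (AlgebraicClosure ℚ) k := fun k ↦ by
    rw [eq_ratCast (algebraMap ℚ (ringClassField K ιK m)) k, map_ratCast,
      eq_ratCast (algebraMap ℚ (AlgebraicClosure ℚ)) k]
  -- restrict `g` to `K[m]`
  obtain ⟨σ, hσ⟩ := exists_algEquiv_comp_eq emb hemb g
  have hσ' : ∀ y : ringClassField K ιK m, g • emb y = emb (σ y) := fun y ↦ hσ y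
  rw [hσ', hσ']
  suffices hσσ : σ * σ = 1 by rw [← AlgEquiv.mul_apply, hσσ, AlgEquiv.one_apply]
  -- `σ²` fixes `K`: the index of `𝒢_m` in `Aut_ℚ(K[m])` is `2`
  obtain ⟨τc, hτc⟩ := RingClassConj.exists_conj_algEquiv hK ιK hm
  have hmemG : σ * σ ∈ ringClassGal ιK m :=
    Subgroup.mul_self_mem_of_index_two (RingClassConj.index_ringClassGal_eq_two hτc hK) σ
  -- `σ²` as a `K`-automorphism
  obtain ⟨φ, -, hφ⟩ := RingClassTower.exists_hom_ringClassGal_algEquiv ιK m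
  set σ₂ : ringClassField K ιK m ≃ₐ[K] ringClassField K ιK m := φ ⟨σ * σ, hmemG⟩ with hσ₂def
  have hσ₂ : ∀ y, σ₂ y = (σ * σ) y := fun y ↦ hφ _ y
  -- the integral structure
  haveI : Module.Finite (𝓞 K) (𝓞 (ringClassField K ιK m)) :=
    IsIntegralClosure.finite (𝓞 K) K (ringClassField K ιK m) (𝓞 (ringClassField K ιK m))
  haveI : IsGaloisGroup (ringClassField K ιK m ≃ₐ[K] ringClassField K ιK m) (𝓞 K)
      (𝓞 (ringClassField K ιK m)) :=
    IsGaloisGroup.of_isFractionRing _ (𝓞 K) (𝓞 (ringClassField K ιK m)) K (ringClassField K ιK m)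
  -- `𝓞 K[m] → \bar ℤ` along `emb`
  let ι : 𝓞 (ringClassField K ιK m) →+* absIntegers (𝓞 ℚ) ℚ :=
    (emb.comp (algebraMap (𝓞 (ringClassField K ιK m)) (ringClassField K ιK m))).codRestrict
      (integralClosure (𝓞 ℚ) (AlgebraicClosure ℚ)) fun y ↦ by
        rw [mem_integralClosure_iff]
        have hy : IsIntegral ℤ (emb (algebraMap _ (ringClassField K ιK m) y)) :=
          (RingOfIntegers.isIntegral_coe y).map emb.toIntAlgHom
        exact hy.tower_top
  have hιcoe : ∀ y : 𝓞 (ringClassField K ιK m),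
      ((ι y : absIntegers (𝓞 ℚ) ℚ) : AlgebraicClosure ℚ) = emb (y : ringClassField K ιK m) :=
    fun y ↦ rfl
  -- the prime `P = 𝔓 ∩ 𝓞 K[m]`
  haveI : 𝔓.IsPrime := h𝔓.1
  set P : Ideal (𝓞 (ringClassField K ιK m)) := 𝔓.comap ι with hPdef
  haveI hPprime : P.IsPrime := Ideal.comap_isPrime ι 𝔓
  -- `σ₂` lies in the inertia group of `P` over `K`
  have hmem : σ₂ ∈ P.inertia (ringClassField K ιK m ≃ₐ[K] ringClassField K ιK m) := by
    intro y
    change σ₂ • y - y ∈ Ideal.comap ι 𝔓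
    rw [Ideal.mem_comap]
    have h1 : ι (σ₂ • y) = (g * g) • ι y := by
      apply Subtype.ext
      rw [integralClosure.coe_smul, hιcoe, hιcoe, mul_smul]
      change emb (σ₂ (y : ringClassField K ιK m)) = _
      rw [hσ₂, AlgEquiv.mul_apply, ← hσ', ← hσ']
    have hsub : ι (σ₂ • y - y) = (g * g) • ι y - ι y := (map_sub ι _ _).trans (by rw [h1])
    exact hsub ▸ ((𝔓.inertia (absoluteGaloisGroup ℚ)).mul_mem hg hg) (ι y)
  -- the prime `𝔭 = P ∩ 𝓞 K` contains `q`, is non-zero, and does not divide `m`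
  have hqu : ((q : ℕ) : 𝓞 ℚ) ∈ u.asIdeal := by rw [← hu]; exact natCast_natGenerator_mem u
  have hq𝔓 : algebraMap (𝓞 ℚ) (absIntegers (𝓞 ℚ) ℚ) ((q : ℕ) : 𝓞 ℚ) ∈ 𝔓 := by
    have h := hqu
    rw [h𝔓.2.over, Ideal.under_def, Ideal.mem_comap] at h
    exact h
  have hqP : ((q : ℕ) : 𝓞 (ringClassField K ιK m)) ∈ P := by
    rw [hPdef, Ideal.mem_comap]
    have : ι ((q : ℕ) : 𝓞 (ringClassField K ιK m)) =
        algebraMap (𝓞 ℚ) (absIntegers (𝓞 ℚ) ℚ) ((q : ℕ) : 𝓞 ℚ) := by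
      rw [map_natCast, map_natCast]
    rw [this]
    exact hq𝔓
  set 𝔭 : Ideal (𝓞 K) := P.under (𝓞 K) with h𝔭def
  have hq𝔭 : ((q : ℕ) : 𝓞 K) ∈ 𝔭 := by
    rw [h𝔭def, Ideal.under_def, Ideal.mem_comap, map_natCast]
    exact hqP
  have h𝔭ne : 𝔭 ≠ ⊥ := fun h ↦ by
    rw [h, Ideal.mem_bot] at hq𝔭
    exact (Nat.cast_ne_zero.mpr hq.ne_zero) hq𝔭
  let v : HeightOneSpectrum (𝓞 K) := ⟨𝔭, Ideal.IsPrime.under (𝓞 K) P, h𝔭ne⟩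
  have hv : ¬ Ideal.span {((m : ℕ) : 𝓞 K)} ≤ v.asIdeal := fun hle ↦ by
    have hmv : ((m : ℕ) : 𝓞 K) ∈ 𝔭 := hle (Ideal.mem_span_singleton_self _)
    have hcop : IsCoprime (q : ℤ) (m : ℤ) :=
      Nat.isCoprime_iff_coprime.mpr ((Nat.Prime.coprime_iff_not_dvd hq).mpr hqm)
    obtain ⟨a, b, hab⟩ := hcop
    have h1 : (1 : 𝓞 K) ∈ 𝔭 := by
      have : ((a : 𝓞 K) * (q : ℕ) + (b : 𝓞 K) * (m : ℕ)) = 1 := by exact_mod_cast hab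
      rw [← this]
      exact 𝔭.add_mem (𝔭.mul_mem_left _ hq𝔭) (𝔭.mul_mem_left _ hmv)
    exact (Ideal.IsPrime.under (𝓞 K) P).ne_top ((Ideal.eq_top_iff_one _).mpr h1)
  -- `K[m]/K` is unramified at `𝔭`, so the inertia group of `P` over `K` is trivial
  have hunr := isUnramifiedIn_ringClassField hK ιK hm hv
  haveI hPover : P.LiesOver v.asIdeal := ⟨rfl⟩
  haveI : Algebra.IsUnramifiedAt (𝓞 K) P := hunr P hPprime hPover
  have he : P.ramificationIdx (𝓞 K) = 1 := Ideal.ramificationIdx_eq_one_of_isUnramifiedAt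
  haveI : v.asIdeal.IsMaximal := v.isMaximal
  have hinertia : P.inertia (ringClassField K ιK m ≃ₐ[K] ringClassField K ιK m) = ⊥ := by
    apply Subgroup.eq_bot_of_card_eq
    rw [Ideal.card_inertia_eq_ramificationIdxIn (G := ringClassField K ιK m ≃ₐ[K] ringClassField K ιK m)
      v.asIdeal P, Ideal.ramificationIdxIn_eq_ramificationIdx v.asIdeal P
      (ringClassField K ιK m ≃ₐ[K] ringClassField K ιK m), he]
  rw [hinertia, Subgroup.mem_bot] at hmem
  refine AlgEquiv.ext fun y ↦ ?_
  rw [← hσ₂, hmem, AlgEquiv.one_apply, AlgEquiv.one_apply]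

/-- **On points, in the tree's `ℚ̄`-currency**: for `W/ℚ`, a Kolyvagin–Heegner datum `d` at a
level `m ≠ 0` (embedding `d.emb : K[m] → K̄`, `d.toGeomPoints : E(K[m]) → E(K̄)`) and the
identification `RatClosure.pointsEquiv W : E(ℚ̄) ≃ E(K̄)`, every inertia element `g ∈ Γ_ℚ` above a
prime `q ∤ m` acts on the transported point `θ⁻¹(d.toGeomPoints P) ∈ E(ℚ̄)` through an involution:
`g • g • θ⁻¹(P) = θ⁻¹(P)` — the hypothesis `hsq` of `kolyvaginClass_mem_selmerLocalKer_of_sq_of_deep`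
for `A = θ⁻¹(E(K[m]))`. [cite: Cox2013, §9.A Lemma 9.3] [cite: GrossLMS1991, §4 (proof of Lemma 4.3)] -/
theorem smul_smul_pointsEquiv_symm_toGeomPoints_eq_of_mem_inertia {N : ℕ} [NeZero N]
    (W : WeierstrassCurve ℚ) (hK : IsImaginaryQuadratic K)
    {Dt : ModularForms.ModularParametrizationData W N} {β : ℤ} {ιK : K →+* ℂ} {m : ℕ} (hm : m ≠ 0)
    (d : KolyvaginHeegnerData Dt β ιK m)
    {q : ℕ} (hq : q.Prime) (hqm : ¬ q ∣ m)
    {u : HeightOneSpectrum (𝓞 ℚ)} (hu : (primesEquiv u : ℕ) = q)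
    {𝔓 : Ideal (absIntegers (𝓞 ℚ) ℚ)} (h𝔓 : 𝔓 ∈ u.primesAbove)
    {g : absoluteGaloisGroup ℚ} (hg : g ∈ 𝔓.inertia (absoluteGaloisGroup ℚ))
    (P : (W.baseChange (ringClassField K ιK m)).toAffine.Point) :
    g • g • (RatClosure.pointsEquiv (K := K) W).symm (d.toGeomPoints P) =
      (RatClosure.pointsEquiv (K := K) W).symm (d.toGeomPoints P) := by
  have key := apply_apply_emb_eq_of_mem_inertia hK ιK hm
    (((Literature.NumberTheory.EllipticCurves.absClosureEquiv ℚ K).symm.toRingEquiv.toRingHom).comp d.emb) hq hqm hu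
    h𝔓 hg
  rcases P with _ | ⟨x, y, h⟩
  · change g • g • (RatClosure.pointsEquiv (K := K) W).symm (d.toGeomPoints 0) =
      (RatClosure.pointsEquiv (K := K) W).symm (d.toGeomPoints 0)
    rw [map_zero, map_zero, smul_zero, smul_zero]
  · exact Affine.Point.some_eq_some_of_eq (key x) (key y)

end Summit.BirchSwinnertonDyer.BirchSwinnertonDyer.Theorems.KolyvaginGenusTwo

end
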